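import Literature.Algebra.Lie.LefschetzModuleStringReversal
import HarnessLib

/-!
# The Lefschetz involution `*_L` of a Lefschetz module, constructed (André 1996, §1.1; Kleiman 1968, 1.4.2)

Topic `Literature/Algebra/Lie` (namespace `Literature.Algebra.Lie`).  Lane `lit-hodgefound` (Track 2 foundations library),
prover seat `lit-hodgefound-p34` (generation 29, row g29-#2), a sequel of `LefschetzModule.lean` (row A1-88 of seat
`lit-hodgefound-skel-1`: `degreeSpace`, `IsZGrading`, `HasLefschetzProperty`, the inverses `g_n = HasLefschetzProperty.inv`, the
partner `f = HasLefschetzProperty.dual`) and of `LefschetzModuleStringReversal.lean` (`IsStringReversal`, Kleiman's polynomial,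
`dual_mem_adjoin`).  That file ABSTRACTED André's `*_L` to "any operator `s` reversing the `𝔰𝔩₂`-strings"; this file CONSTRUCTS
the operator for every Lefschetz operator `e` on a `ℤ`-graded `(M, h)` and proves that it reverses the strings, is an involution,
is unique with that property, anti-commutes with `h`, commutes with every operator commuting with `h` and `e`, and that
`N = *_L e *_L` and `e` are generalized inverses of each other.  DEFINITIONS WITH BODIES (`HasLefschetzProperty.involutionPiece`,
`HasLefschetzProperty.lefschetzInvolution`) and PROVED theorems only (no named fact, no `sorry`, no instance, no notation;
D-0026 net debt `0`).

## Sources, VERBATIM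

Y. André, *Pour une théorie inconditionnelle des motifs*, Publ. Math. IHÉS **83** (1996) 5–49 [Andre1996Motifs] (held
`paper:doi-10-1007-bf02698643`), §1.1 (p. 10 = PDF p0007 L24–L40): "Soit `X` un `K`-schéma projectif lisse purement de dimension
`d`, muni de la classe `η` […] d'un faisceau inversible ample […] et soit `L = L_η` l'opérateur de Lefschetz sur `H*(X)` défini par le
cup-produit avec `η`. On dit que `X` vérifie le théorème de Lefschetz fort (relativement à `H*` et `η`) si pour tout `i ≤ d`,
`L^{d-i} : Hⁱ(X) → H^{2d-i}(X)` est un isomorphisme. On a alors pour tout `j` la décomposition de Lefschetz : `Hʲ(X) = ⊕ Lᵏ P^{j-2k}(X)`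
[…] avec `Pⁱ(X) = Hⁱ(X) ∩ Ker L^{d-i+1}` pour `i ≤ d`. […] On définit aussi les involutions de Lefschetz et de Hodge respectivement
par les formules : `*_L x = Σ L^{d-j+k} x_{j-2k}`, `*_H x = Σ (-1)^{(j-2k)(j-2k+1)/2} L^{d-j+k} x_{j-2k}`"; (p. 11 = p0008 L10–L14):
"On voit immédiatement que `Pʲ(X) = Hʲ(X) ∩ Ker *_L L *_L` et que l'opérateur `*_L L *_L = *_H L *_H`, proportionnel à `ᶜΛ` sur
chaque composante de Lefschetz, est un inverse à droite de `L` sur l'image de `L`. Remarquons aussi que `L`, `*_L`, `*_H` et `ᶜΛ`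
sont auto-adjoints relativement à l'accouplement de dualité de Poincaré"; Prop. 1.2 (p. 11): "Les sous-algèbres `ℚ[L, *_L]`,
`ℚ[L, *_H]`, `ℚ[L, *_L L *_L]`, `ℚ[L, ᶜΛ]` de `End H*(X)` sont égales […] *Preuve.* — Pour la première assertion, on renvoie à
[Kl68] 1.4.4, 1.4.5."
J. S. Milne, *Lefschetz classes on abelian varieties*, Duke Math. J. **96** (1999) [Milne1999LefschetzClasses], proof of Thm. 5.9
(p. 665): "It is known (e.g., Kleiman 1968, p367) that `Λ`, regarded as a map of cohomology groups, is inverse to `L`. Since the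
latter is Lefschetz, it commutes with the action of `L(A)`, which implies that the same is true of `Λ`".
S. L. Kleiman, *Algebraic cycles and the Weil conjectures* (1968) [Kleiman1968AlgebraicCycles], §1.4, 1.4.2–1.4.5 — as cited by
André and Milne, loc. cit.
E. Looijenga, V. A. Lunts, Invent. Math. **129** (1997) [LooijengaLunts1997], §1 (1.1) (the graded setting `(M, h)`, `e`, `M_{±k}`).

## Rendering (dictionary, continuing `LefschetzModule.lean` / `LefschetzModuleStringReversal.lean`)

* André's `Hʲ(X)` with `h = j - d` is `M_{j-d} = degreeSpace h (j - d)`; "`i ≤ d`", `Hⁱ = M_{-k}` with `k = d - i ≥ 0`; the hard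
  Lefschetz isomorphism `L^{d-i} : Hⁱ → H^{2d-i}` is A1-88's `e^k : M_{-k} ≅ M_k` (`HasLefschetzProperty.bijOn`, inverse `g_k = inv`).
* On the Lefschetz component `Lᵏ x_{j-2k}` of `x ∈ Hʲ` the printed `*_L` is `L^{d-j+k} x_{j-2k}`; summing over `k`, for `j ≤ d` this
  is `L^{d-j}(Σ Lᵏ x_{j-2k}) = L^{d-j} x`, and for `j ≥ d`, writing `x = L^{j-d} y` (`y ∈ H^{2d-j}`), it is `y = (L^{j-d})⁻¹ x` — André's
  own description "l'isomorphisme de Lefschetz ou son inverse" (§0.2).  Hence **`*_L` = `e^{-m}` on `M_m` for `m ≤ 0` and `g_m` on `M_m`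
  for `m > 0`** (`involutionPiece`), glued over `M = ⊕ₘ M_m` (`lefschetzInvolution`, exactly as A1-88 glues `dual`).  No Lefschetz
  decomposition is needed for `*_L` (it is for `*_H`, SCOPE).
* "`*_L L *_L`" is `s * e * s` (the `N` of `LefschetzModuleStringReversal` §3); "`ℚ[L, *_L]`" is `Algebra.adjoin K {e, s}`.

## Contents (all proved; `s = L.lefschetzInvolution hgr`)

* §1 `involutionPiece`, `lefschetzInvolution`, `lefschetzInvolution_apply_of_mem`, **`lefschetzInvolution_apply_of_mem_neg`**
  (`s = eᵏ` on `M_{-k}`), `lefschetzInvolution_apply_of_mem_pos` (`s = g_k` on `M_k`), **`lefschetzInvolution_apply_pow_of_mem_neg`**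
  (`s (eᵏ x) = x`), `pow_apply_lefschetzInvolution_of_mem_pos` (`eᵏ (s x) = x` on `M_k`), `lefschetzInvolution_apply_mem`
  (`s M_m ⊆ M_{-m}`), `lefschetzInvolution_apply_primitive` (`s p = eᵏ p`: bottom ↦ top of a string).
* §2 **`isStringReversal_lefschetzInvolution`** (`s (eʲ p) = e^{k-j} p`: A1-88's abstract `*_L` IS this operator),
  **`lefschetzInvolution_mul_self`** (`s² = 1`), `shiftedDegree`-free **`mul_lefschetzInvolution_eq_neg`** (`h s = -s h`: degree
  reversal), **`commute_lefschetzInvolution`** (Milne's mechanism: `u h = h u`, `u e = e u ⇒ u s = s u`).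
* §3 for ANY string reversal `s` (finite dimension): **`IsStringReversal.eq_lefschetzInvolution`** (uniqueness),
  **`IsStringReversal.mul_conj_mul_mul_eq`** (`e (s e s) e = e` — "`*_L L *_L` […] inverse à droite de `L` sur l'image de `L`",
  Milne's "`Λ` […] is inverse to `L`"), `IsStringReversal.conj_mul_mul_conj_eq` (`(s e s) e (s e s) = s e s`),
  **`IsStringReversal.primitiveSpace_eq_inf_ker_conj`** ("`Pʲ(X) = Hʲ(X) ∩ Ker *_L L *_L`"), and the corollaries of A1-88's
  Kleiman 1.4.4 for the constructed operator: **`dual_mem_adjoin_lefschetzInvolution`** (`ᶜΛ ∈ K[e, *_L]`),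
  `dual_mem_adjoin_conj_lefschetzInvolution` (`ᶜΛ ∈ K[e, *_L e *_L]`).

## SCOPE (not formalised here)

The Hodge involution `*_H` (the sign `(-1)^{(j-2k)(j-2k+1)/2}` by primitive degree; next row), the reverse inclusion
`*_L ∈ K[L, ᶜΛ]` (Kleiman 1.4.5) and the self-adjointness sentence are not formalised here.  Concrete instances of the same operator
on geometric carriers already in the tree, BY NAME: `HodgeTheory.lefschetzInvolution` / `HodgeTheory.totalLefschetzInvolution`
(`AlgebraicGeometry/HodgeTheory/MotivatedClasses.lean`, `…/DualLefschetzInLefschetzInvolutionAlgebra.lean`; singular cohomology),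
with `isStringReversal_totalLefschetzInvolution` (`…AlgebraHolds.lean`) — not restated, not imported.

## References

* [Andre1996Motifs] Y. André, *Pour une théorie inconditionnelle des motifs*, Publ. Math. IHÉS 83 (1996) 5–49, §0.2 (p. 7), §1.1
  (pp. 10–11), Prop. 1.2 (p. 11).
* [Kleiman1968AlgebraicCycles] S. L. Kleiman, *Algebraic cycles and the Weil conjectures*, in: Dix exposés sur la cohomologie des
  schémas (1968) 359–386, §1.4 (1.4.2–1.4.5).
* [Milne1999LefschetzClasses] J. S. Milne, *Lefschetz classes on abelian varieties*, Duke Math. J. 96 (1999) 639–675, §5 Thm. 5.9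
  (proof, p. 665).
* [LooijengaLunts1997] E. Looijenga, V. A. Lunts, *A Lie algebra attached to a projective variety*, Invent. Math. 129 (1997) 361–412,
  §1 (1.1).
-/

noncomputable section

namespace Literature.Algebra.Lie

open Module Function Set
open HasLefschetzProperty (primitiveSpace mem_primitiveSpace_iff)

variable {K : Type*} [Field K] {M : Type*} [AddCommGroup M] [Module K M] {h e : Module.End K M}

namespace HasLefschetzProperty

/-! ### §1 The operator `*_L`: `eᵏ` on `M_{-k}`, the inverse of `eᵏ` on `M_k` -/

/-- **The piece of `*_L` on `M_m`**: "l'isomorphisme de Lefschetz ou son inverse" — `e^{-m}` for `m ≤ 0` (on `Hʲ`, `j ≤ d`: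
`L^{d-j}`) and the inverse `g_m` of `e^m : M_{-m} ≅ M_m` for `m > 0` (on `Hʲ`, `j > d`: `(L^{j-d})⁻¹`).
[cite: Andre1996Motifs, §0.2 (p. 7) and §1.1 (p. 10, definition of *_L)] -/
def involutionPiece (L : HasLefschetzProperty h e) (m : ℤ) : degreeSpace h m →ₗ[K] M :=
  if m ≤ 0 then (e ^ (-m).toNat) ∘ₗ (degreeSpace h m).subtype else L.inv m

/-- On `M_m`, `m ≤ 0`, the piece is `e^{-m}`. [cite: Andre1996Motifs, §1.1 (p. 10)] -/
theorem involutionPiece_apply_of_nonpos (L : HasLefschetzProperty h e) {m : ℤ} (hm : m ≤ 0) (x : degreeSpace h m) :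
    L.involutionPiece m x = (e ^ (-m).toNat) x := by
  rw [involutionPiece, if_pos hm, LinearMap.comp_apply, Submodule.subtype_apply]

/-- On `M_m`, `m > 0`, the piece is `g_m`. [cite: Andre1996Motifs, §1.1 (p. 10)] -/
theorem involutionPiece_apply_of_pos (L : HasLefschetzProperty h e) {m : ℤ} (hm : 0 < m) (x : degreeSpace h m) :
    L.involutionPiece m x = L.inv m x := by
  rw [involutionPiece, if_neg (not_le.2 hm)]

variable [CharZero K]

/-- **André's Lefschetz involution `*_L`** of the Lefschetz module `(M, h, e)` ("`*_L x = Σ L^{d-j+k} x_{j-2k}`", i.e. `L^{d-j}` on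
`Hʲ` for `j ≤ d` and the inverse of `L^{j-d}` on `Hʲ` for `j ≥ d`): the pieces `involutionPiece` glued along `M = ⊕ₘ M_m`.
[cite: Andre1996Motifs, §1.1 (p. 10, "involutions de Lefschetz et de Hodge")] [cite: Kleiman1968AlgebraicCycles, §1.4, 1.4.2] -/
def lefschetzInvolution (L : HasLefschetzProperty h e) (hgr : IsZGrading h) : Module.End K M :=
  (DirectSum.toModule K ℤ M fun m ↦ L.involutionPiece m) ∘ₗ
    ((LinearEquiv.ofBijective (DirectSum.coeLinearMap fun m : ℤ ↦ degreeSpace h m)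
      (isInternal_degreeSpace hgr)).symm : M →ₗ[K] DirectSum ℤ fun m ↦ degreeSpace h m)

/-- `*_L` agrees with its piece on `M_m`. [cite: Andre1996Motifs, §1.1 (p. 10)] -/
theorem lefschetzInvolution_apply_of_mem (L : HasLefschetzProperty h e) (hgr : IsZGrading h) {m : ℤ} {x : M}
    (hx : x ∈ degreeSpace h m) : L.lefschetzInvolution hgr x = L.involutionPiece m ⟨x, hx⟩ := by
  classical
  rw [lefschetzInvolution, LinearMap.comp_apply, LinearEquiv.coe_coe]
  have h1 : (LinearEquiv.ofBijective (DirectSum.coeLinearMap fun m : ℤ ↦ degreeSpace h m)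
      (isInternal_degreeSpace hgr)).symm x = DirectSum.lof K ℤ (fun m ↦ degreeSpace h m) m ⟨x, hx⟩ := by
    apply (LinearEquiv.ofBijective (DirectSum.coeLinearMap fun m : ℤ ↦ degreeSpace h m)
      (isInternal_degreeSpace hgr)).injective
    rw [LinearEquiv.apply_symm_apply, LinearEquiv.ofBijective_apply, DirectSum.lof_eq_of, DirectSum.coeLinearMap_of]
  rw [h1, DirectSum.toModule_lof]

/-- **`*_L = eᵏ` on `M_{-k}`** ("`*_L x = L^{d-j} x` on `Hʲ`, `j = d - k ≤ d`"). [cite: Andre1996Motifs, §1.1 (p. 10)] [cite: Andre1996Motifs, §0.2 (p. 7)] -/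
theorem lefschetzInvolution_apply_of_mem_neg (L : HasLefschetzProperty h e) (hgr : IsZGrading h) {k : ℕ} {x : M}
    (hx : x ∈ degreeSpace h (-(k : ℤ))) : L.lefschetzInvolution hgr x = (e ^ k) x := by
  rw [L.lefschetzInvolution_apply_of_mem hgr hx, L.involutionPiece_apply_of_nonpos (by omega)]
  simp only [neg_neg, Int.toNat_natCast]

/-- **`*_L = g_k = (eᵏ)⁻¹` on `M_k`, `k > 0`** ("ou son inverse"). [cite: Andre1996Motifs, §0.2 (p. 7)] [cite: Andre1996Motifs, §1.1 (p. 10)] -/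
theorem lefschetzInvolution_apply_of_mem_pos (L : HasLefschetzProperty h e) (hgr : IsZGrading h) {k : ℕ} (hk : 0 < k) {x : M}
    (hx : x ∈ degreeSpace h (k : ℤ)) : L.lefschetzInvolution hgr x = L.inv k ⟨x, hx⟩ := by
  rw [L.lefschetzInvolution_apply_of_mem hgr hx, L.involutionPiece_apply_of_pos (by exact_mod_cast hk)]

/-- On a primitive vector `*_L` climbs to the top of its string: `*_L p = eᵏ p` for `p ∈ P_{-k}`.
[cite: Andre1996Motifs, §1.1 (p. 10: *_L x_i = L^{d-i} x_i for x_i primitive)] -/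
theorem lefschetzInvolution_apply_primitive (L : HasLefschetzProperty h e) (hgr : IsZGrading h) {k : ℕ} {p : M}
    (hp : p ∈ primitiveSpace h e k) : L.lefschetzInvolution hgr p = (e ^ k) p :=
  L.lefschetzInvolution_apply_of_mem_neg hgr (mem_primitiveSpace_iff.1 hp).1

omit [CharZero K] in
/-- `eᵏ x ∈ M_k` for `x ∈ M_{-k}`. [cite: LooijengaLunts1997, §1 (1.1) p. 4 L1–L2] -/
theorem pow_apply_mem_of_mem_neg (L : HasLefschetzProperty h e) {k : ℕ} {x : M} (hx : x ∈ degreeSpace h (-(k : ℤ))) :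
    (e ^ k) x ∈ degreeSpace h (k : ℤ) := by
  have h1 := L.pow_apply_mem hx k
  rwa [show (-(k : ℤ) + 2 * (k : ℕ) : ℤ) = k by ring] at h1

omit [CharZero K] in
/-- `eᵏ (g_k y) = y` for `y ∈ M_k` (A1-88's `pow_apply_inv` with a natural-number exponent). [cite: LooijengaLunts1997, §1 (1.1) p. 4 L1–L2] -/
theorem pow_apply_inv_natCast (L : HasLefschetzProperty h e) {k : ℕ} (y : degreeSpace h (k : ℤ)) :
    (e ^ k) (L.inv k y) = y := by
  have h1 := L.pow_apply_inv (n := (k : ℤ)) (by omega) y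
  rwa [Int.toNat_natCast] at h1

/-- **`*_L (eᵏ x) = x` for `x ∈ M_{-k}`**: on `M_k = eᵏ M_{-k}` the involution undoes `eᵏ`.
[cite: Andre1996Motifs, §1.1 (p. 10)] [cite: Andre1996Motifs, §0.2 (p. 7)] -/
theorem lefschetzInvolution_apply_pow_of_mem_neg (L : HasLefschetzProperty h e) (hgr : IsZGrading h) {k : ℕ} {x : M}
    (hx : x ∈ degreeSpace h (-(k : ℤ))) : L.lefschetzInvolution hgr ((e ^ k) x) = x := by
  rcases Nat.eq_zero_or_pos k with rfl | hk
  · rw [pow_zero, Module.End.one_apply, L.lefschetzInvolution_apply_of_mem_neg hgr hx, pow_zero, Module.End.one_apply]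
  have hy := L.pow_apply_mem_of_mem_neg hx
  rw [L.lefschetzInvolution_apply_of_mem_pos hgr hk hy]
  -- `eᵏ` is injective on `M_{-k}` and `eᵏ (g_k (eᵏ x)) = eᵏ x`
  refine (L.bijOn k).injOn (L.inv_mem (by omega) _) hx ?_
  exact L.pow_apply_inv_natCast ⟨(e ^ k) x, hy⟩

/-- `eᵏ (*_L x) = x` for `x ∈ M_k`. [cite: Andre1996Motifs, §1.1 (p. 10)] -/
theorem pow_apply_lefschetzInvolution_of_mem_pos (L : HasLefschetzProperty h e) (hgr : IsZGrading h) {k : ℕ} {x : M}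
    (hx : x ∈ degreeSpace h (k : ℤ)) : (e ^ k) (L.lefschetzInvolution hgr x) = x := by
  rcases Nat.eq_zero_or_pos k with rfl | hk
  · rw [pow_zero, Module.End.one_apply,
      L.lefschetzInvolution_apply_of_mem_neg hgr (k := 0) (by simpa using hx), pow_zero, Module.End.one_apply]
  rw [L.lefschetzInvolution_apply_of_mem_pos hgr hk hx]
  exact L.pow_apply_inv_natCast ⟨x, hx⟩

/-- `*_L x ∈ M_{-k}` for `x ∈ M_k`. [cite: Andre1996Motifs, §1.1 (p. 10)] -/
theorem lefschetzInvolution_apply_mem_neg_of_mem_pos (L : HasLefschetzProperty h e) (hgr : IsZGrading h) {k : ℕ} {x : M}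
    (hx : x ∈ degreeSpace h (k : ℤ)) : L.lefschetzInvolution hgr x ∈ degreeSpace h (-(k : ℤ)) := by
  rcases Nat.eq_zero_or_pos k with rfl | hk
  · rw [L.lefschetzInvolution_apply_of_mem_neg hgr (k := 0) (by simpa using hx), pow_zero, Module.End.one_apply]
    simpa using hx
  rw [L.lefschetzInvolution_apply_of_mem_pos hgr hk hx]
  exact L.inv_mem (by omega) _

/-- **`*_L` reverses the degrees: `*_L (M_m) ⊆ M_{-m}`** (`Hʲ → H^{2d-j}`). [cite: Andre1996Motifs, §1.1 (p. 10)] -/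
theorem lefschetzInvolution_apply_mem (L : HasLefschetzProperty h e) (hgr : IsZGrading h) {m : ℤ} {x : M}
    (hx : x ∈ degreeSpace h m) : L.lefschetzInvolution hgr x ∈ degreeSpace h (-m) := by
  rcases le_or_gt m 0 with hm | hm
  · obtain ⟨k, rfl⟩ : ∃ k : ℕ, m = -(k : ℤ) := ⟨(-m).toNat, by omega⟩
    rw [L.lefschetzInvolution_apply_of_mem_neg hgr hx, neg_neg]
    exact L.pow_apply_mem_of_mem_neg hx
  · obtain ⟨k, rfl⟩ : ∃ k : ℕ, m = (k : ℤ) := ⟨m.toNat, by omega⟩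
    exact L.lefschetzInvolution_apply_mem_neg_of_mem_pos hgr hx

/-! ### §2 `*_L` reverses the strings, is an involution, reverses the grading, and commutes with what commutes with `h` and `e` -/

/-- **The constructed `*_L` IS a string reversal in the sense of `LefschetzModuleStringReversal`**: `*_L (eʲ p) = e^{k-j} p` for
`p ∈ P_{-k}`, `j ≤ k` (André's "`*_L (Lᵏ x_i) = L^{d-i-k} x_i`"), by that file's criterion `isStringReversal_of_apply_eq` from
§1. [cite: Andre1996Motifs, §1.1 (p. 10, definition of *_L)] -/
theorem isStringReversal_lefschetzInvolution (L : HasLefschetzProperty h e) (hgr : IsZGrading h) :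
    IsStringReversal h e (L.lefschetzInvolution hgr) :=
  isStringReversal_of_apply_eq L (fun _ _ hx ↦ L.lefschetzInvolution_apply_of_mem_neg hgr hx)
    (fun _ _ hx ↦ L.lefschetzInvolution_apply_pow_of_mem_neg hgr hx)

/-- **`*_L` is an involution: `*_L ∘ *_L = 1`** ("les involutions de Lefschetz et de Hodge"). On `M_{-k}`: `*_L (*_L x) = *_L (eᵏ x) = x`;
on `M_k`: `x = eᵏ y`, `*_L x = y`, `*_L y = eᵏ y = x`. [cite: Andre1996Motifs, §1.1 (p. 10, "involutions")] -/
theorem lefschetzInvolution_mul_self (L : HasLefschetzProperty h e) (hgr : IsZGrading h) :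
    L.lefschetzInvolution hgr * L.lefschetzInvolution hgr = 1 := by
  ext x
  have hx : x ∈ ⨆ k : ℤ, degreeSpace h k := by rw [hgr]; exact Submodule.mem_top
  refine Submodule.iSup_induction (fun k : ℤ ↦ degreeSpace h k)
    (motive := fun x ↦ (L.lefschetzInvolution hgr * L.lefschetzInvolution hgr) x = (1 : Module.End K M) x) hx
    (fun m x hx ↦ ?_) (by simp) (fun x y hx hy ↦ by rw [map_add, map_add, hx, hy])
  rw [Module.End.mul_apply, Module.End.one_apply]
  rcases le_or_gt m 0 with hm | hm
  · obtain ⟨k, rfl⟩ : ∃ k : ℕ, m = -(k : ℤ) := ⟨(-m).toNat, by omega⟩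
    rw [L.lefschetzInvolution_apply_of_mem_neg hgr hx, L.lefschetzInvolution_apply_pow_of_mem_neg hgr hx]
  · obtain ⟨k, rfl⟩ : ∃ k : ℕ, m = (k : ℤ) := ⟨m.toNat, by omega⟩
    rw [L.lefschetzInvolution_apply_of_mem_neg hgr (L.lefschetzInvolution_apply_mem_neg_of_mem_pos hgr hx),
      L.pow_apply_lefschetzInvolution_of_mem_pos hgr hx]

/-- `*_L (*_L x) = x`. [cite: Andre1996Motifs, §1.1 (p. 10, "involutions")] -/
theorem lefschetzInvolution_lefschetzInvolution (L : HasLefschetzProperty h e) (hgr : IsZGrading h) (x : M) :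
    L.lefschetzInvolution hgr (L.lefschetzInvolution hgr x) = x := by
  rw [← Module.End.mul_apply, L.lefschetzInvolution_mul_self hgr, Module.End.one_apply]

/-- **`*_L` reverses the grading: `h *_L = - *_L h`** (`*_L` maps `Hʲ` to `H^{2d-j}`, i.e. has `h`-weight `m ↦ -m`).
[cite: Andre1996Motifs, §1.1 (p. 10)] -/
theorem mul_lefschetzInvolution_eq_neg (L : HasLefschetzProperty h e) (hgr : IsZGrading h) :
    h * L.lefschetzInvolution hgr = -(L.lefschetzInvolution hgr * h) := by
  ext x
  have hx : x ∈ ⨆ k : ℤ, degreeSpace h k := by rw [hgr]; exact Submodule.mem_top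
  refine Submodule.iSup_induction (fun k : ℤ ↦ degreeSpace h k)
    (motive := fun x ↦ (h * L.lefschetzInvolution hgr) x = (-(L.lefschetzInvolution hgr * h)) x) hx
    (fun m x hx ↦ ?_) (by simp) (fun x y hx hy ↦ by rw [map_add, map_add, hx, hy])
  rw [Module.End.mul_apply, LinearMap.neg_apply, Module.End.mul_apply, mem_degreeSpace_iff.1 hx, map_smul,
    mem_degreeSpace_iff.1 (L.lefschetzInvolution_apply_mem hgr hx), Int.cast_neg, neg_smul]

omit [CharZero K] in
/-- An operator commuting with `h` preserves the degree parts. [cite: LooijengaLunts1997, §1 (1.1) p. 3 ("u has degree k if and only if [h, u] = ku", k = 0)] -/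
theorem apply_mem_degreeSpace_of_commute {u : Module.End K M} (hu : Commute u h) {m : ℤ} {x : M} (hx : x ∈ degreeSpace h m) :
    u x ∈ degreeSpace h m := by
  rw [mem_degreeSpace_iff] at hx ⊢
  rw [← Module.End.mul_apply, ← hu.eq, Module.End.mul_apply, hx, map_smul]

/-- **Milne's mechanism ("`L` … commutes with the action of `L(A)`, which implies that the same is true of `Λ`"): an operator `u`
commuting with `h` and with `e` commutes with `*_L`.** On `M_{-k}`, `*_L = eᵏ`; on `M_k ∋ x = eᵏ y`, `u x = eᵏ (u y)` with
`u y ∈ M_{-k}`, so `*_L (u x) = u y = u (*_L x)`. [cite: Milne1999LefschetzClasses, §5 Thm. 5.9 (proof, p. 665)] [cite: Andre1996Motifs, §1.1 (p. 10)] -/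
theorem commute_lefschetzInvolution (L : HasLefschetzProperty h e) (hgr : IsZGrading h) {u : Module.End K M} (huh : Commute u h)
    (hue : Commute u e) : Commute u (L.lefschetzInvolution hgr) := by
  refine LinearMap.ext fun x ↦ ?_
  have hx : x ∈ ⨆ k : ℤ, degreeSpace h k := by rw [hgr]; exact Submodule.mem_top
  refine Submodule.iSup_induction (fun k : ℤ ↦ degreeSpace h k)
    (motive := fun x ↦ (u * L.lefschetzInvolution hgr) x = (L.lefschetzInvolution hgr * u) x) hx
    (fun m x hx ↦ ?_) (by simp) (fun x y hx hy ↦ by rw [map_add, map_add, hx, hy])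
  have hupow : ∀ (k : ℕ) (y : M), u ((e ^ k) y) = (e ^ k) (u y) := fun k y ↦ by
    rw [← Module.End.mul_apply, (hue.pow_right k).eq, Module.End.mul_apply]
  rw [Module.End.mul_apply, Module.End.mul_apply]
  rcases le_or_gt m 0 with hm | hm
  · obtain ⟨k, rfl⟩ : ∃ k : ℕ, m = -(k : ℤ) := ⟨(-m).toNat, by omega⟩
    rw [L.lefschetzInvolution_apply_of_mem_neg hgr hx,
      L.lefschetzInvolution_apply_of_mem_neg hgr (apply_mem_degreeSpace_of_commute huh hx), hupow]
  · obtain ⟨k, rfl⟩ : ∃ k : ℕ, m = (k : ℤ) := ⟨m.toNat, by omega⟩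
    -- `x = eᵏ y` with `y = *_L x ∈ M_{-k}`
    set y := L.lefschetzInvolution hgr x with hy_def
    have hy : y ∈ degreeSpace h (-(k : ℤ)) := L.lefschetzInvolution_apply_mem_neg_of_mem_pos hgr hx
    have hxy : x = (e ^ k) y := (L.pow_apply_lefschetzInvolution_of_mem_pos hgr hx).symm
    rw [hxy, hupow, L.lefschetzInvolution_apply_pow_of_mem_neg hgr (apply_mem_degreeSpace_of_commute huh hy)]

end HasLefschetzProperty

/-! ### §3 Any string reversal: uniqueness, `N = s e s` and `e` are generalized inverses, `P = M_{-k} ∩ ker N`, `ᶜΛ ∈ K[e, *_L]` -/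

section StringReversal

variable [CharZero K] [FiniteDimensional K M] {s : Module.End K M}

/-- **A string reversal is unique — it is the constructed `*_L`** (both reverse every string `p, e p, …, eᵏ p`, and the strings
span `M`). [cite: Andre1996Motifs, §1.1 (p. 10, *_L defined on the Lefschetz decomposition)] -/
theorem IsStringReversal.eq_lefschetzInvolution (hs : IsStringReversal h e s) (L : HasLefschetzProperty h e) (hgr : IsZGrading h) :
    s = L.lefschetzInvolution hgr :=
  L.linearMap_ext_of_strings hgr fun _ _ hp _ hj ↦ by rw [hs hp hj, L.isStringReversal_lefschetzInvolution hgr hp hj]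

/-- **"l'opérateur `*_L L *_L` […] est un inverse à droite de `L` sur l'image de `L`" / "`Λ` […] is inverse to `L`": `e (s e s) e = e`**
for every string reversal `s` (on `eʲ p`: `e^{j+1} p ↦ eʲ p ↦ e^{j+1} p`, and `e^{k+1} p = 0` at the top).
[cite: Andre1996Motifs, §1.1 (p. 11)] [cite: Milne1999LefschetzClasses, §5 Thm. 5.9 (proof, p. 665: "Kleiman 1968, p367")] -/
theorem IsStringReversal.mul_conj_mul_mul_eq (hs : IsStringReversal h e s) (L : HasLefschetzProperty h e) (hgr : IsZGrading h) :
    e * (s * e * s) * e = e := by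
  refine L.linearMap_ext_of_strings hgr fun k p hp j hj ↦ ?_
  rw [Module.End.mul_apply, Module.End.mul_apply, ← Module.End.mul_apply e (e ^ j), ← pow_succ']
  rcases Nat.lt_or_ge j k with hjk | hjk
  · rw [hs.conj_apply_pow_primitive hp (by omega : j + 1 ≤ k), if_neg (Nat.succ_ne_zero j), Nat.add_sub_cancel,
      ← Module.End.mul_apply e (e ^ j), ← pow_succ']
  · rw [show j = k from le_antisymm hj hjk, (mem_primitiveSpace_iff.1 hp).2, map_zero, map_zero]

/-- … and `(s e s) e (s e s) = s e s`: `N = s e s` and `e` are generalized inverses of each other.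
[cite: Andre1996Motifs, §1.1 (p. 11)] [cite: Kleiman1968AlgebraicCycles, §1.4, 1.4.2 (Λ L = id off the top, via André)] -/
theorem IsStringReversal.conj_mul_mul_conj_eq (hs : IsStringReversal h e s) (L : HasLefschetzProperty h e) (hgr : IsZGrading h) :
    (s * e * s) * e * (s * e * s) = s * e * s := by
  refine L.linearMap_ext_of_strings hgr fun k p hp j hj ↦ ?_
  rw [Module.End.mul_apply, Module.End.mul_apply, hs.conj_apply_pow_primitive hp hj]
  split_ifs with hj0
  · rw [map_zero, map_zero]
  · rw [← Module.End.mul_apply e (e ^ (j - 1)), ← pow_succ', show j - 1 + 1 = j by omega,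
      hs.conj_apply_pow_primitive hp hj, if_neg hj0]

/-- **"`Pʲ(X) = Hʲ(X) ∩ Ker *_L L *_L`": the primitive part `P_{-k}` is the part of `M_{-k}` killed by `N = s e s`** (for a string
reversal `s`).  `⊆`: `N` kills the bottom of every string; `⊇`: for `x ∈ M_{-k}` write `x = p + e y` (A1-88's two-term primitive
decomposition); `N x = N (e y)` and `e (N (e y)) = e y` (`e N e = e`), so `N x = 0` forces `e y = 0`.
[cite: Andre1996Motifs, §1.1 (p. 11)] [cite: CattaniElZeinGriffithsLe2014, App. A Prop. A.3.9 (A.3.6)] -/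
theorem IsStringReversal.primitiveSpace_eq_inf_ker_conj (hs : IsStringReversal h e s) (L : HasLefschetzProperty h e)
    (hgr : IsZGrading h) (k : ℕ) : primitiveSpace h e k = degreeSpace h (-(k : ℤ)) ⊓ LinearMap.ker (s * e * s) := by
  refine le_antisymm (fun p hp ↦ ?_) (fun x hx ↦ ?_)
  · have h1 := hs.conj_apply_pow_primitive hp (Nat.zero_le k) (j := 0)
    rw [pow_zero, Module.End.one_apply, if_pos rfl] at h1
    exact Submodule.mem_inf.2 ⟨(mem_primitiveSpace_iff.1 hp).1, LinearMap.mem_ker.2 h1⟩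
  · obtain ⟨hxk, hN⟩ := Submodule.mem_inf.1 hx
    rw [LinearMap.mem_ker] at hN
    obtain ⟨p, hp, y, hy, rfl⟩ := L.exists_primitive_add hxk
    have hNp : (s * e * s) p = 0 := by
      have h1 := hs.conj_apply_pow_primitive hp (Nat.zero_le k) (j := 0)
      rwa [pow_zero, Module.End.one_apply, if_pos rfl] at h1
    rw [map_add, hNp, zero_add] at hN
    have hey : e y = 0 := by
      have h1 := LinearMap.congr_fun (hs.mul_conj_mul_mul_eq L hgr) y
      rw [Module.End.mul_apply, Module.End.mul_apply, hN, map_zero] at h1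
      exact h1.symm
    rw [hey, add_zero]
    exact hp

namespace HasLefschetzProperty

/-- **Kleiman 1968, 1.4.4 / André 1996, Prop. 1.2 for the constructed involution: `ᶜΛ = f ∈ K[e, *_L]`** ("`ℚ[L, *_L] = ℚ[L, ᶜΛ]`",
the inclusion `⊇`; A1-88's `dual_mem_adjoin` applied to `isStringReversal_lefschetzInvolution`).
[cite: Andre1996Motifs, Prop. 1.2 (p. 11)] [cite: Kleiman1968AlgebraicCycles, §1.4, 1.4.4] -/
theorem dual_mem_adjoin_lefschetzInvolution (L : HasLefschetzProperty h e) (hgr : IsZGrading h) :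
    L.dual hgr ∈ Algebra.adjoin K ({e, L.lefschetzInvolution hgr} : Set (Module.End K M)) :=
  L.dual_mem_adjoin hgr (L.isStringReversal_lefschetzInvolution hgr)

/-- … and `ᶜΛ ∈ K[e, *_L e *_L]` ("`ℚ[L, *_L L *_L] = ℚ[L, ᶜΛ]`", the inclusion `⊇`).
[cite: Andre1996Motifs, Prop. 1.2 (p. 11)] [cite: Kleiman1968AlgebraicCycles, §1.4, 1.4.4] -/
theorem dual_mem_adjoin_conj_lefschetzInvolution (L : HasLefschetzProperty h e) (hgr : IsZGrading h) :
    L.dual hgr ∈ Algebra.adjoin K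
      ({e, L.lefschetzInvolution hgr * e * L.lefschetzInvolution hgr} : Set (Module.End K M)) :=
  L.dual_mem_adjoin_conj hgr (L.isStringReversal_lefschetzInvolution hgr)

/-- `P_{-k} = M_{-k} ∩ ker(*_L e *_L)` for the constructed `*_L`. [cite: Andre1996Motifs, §1.1 (p. 11)] -/
theorem primitiveSpace_eq_inf_ker_conj_lefschetzInvolution (L : HasLefschetzProperty h e) (hgr : IsZGrading h) (k : ℕ) :
    primitiveSpace h e k = degreeSpace h (-(k : ℤ)) ⊓
      LinearMap.ker (L.lefschetzInvolution hgr * e * L.lefschetzInvolution hgr) :=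
  (L.isStringReversal_lefschetzInvolution hgr).primitiveSpace_eq_inf_ker_conj L hgr k

/-- `e (*_L e *_L) e = e` for the constructed `*_L`. [cite: Andre1996Motifs, §1.1 (p. 11)] [cite: Milne1999LefschetzClasses, §5 Thm. 5.9 (proof, p. 665)] -/
theorem mul_conj_lefschetzInvolution_mul_eq (L : HasLefschetzProperty h e) (hgr : IsZGrading h) :
    e * (L.lefschetzInvolution hgr * e * L.lefschetzInvolution hgr) * e = e :=
  (L.isStringReversal_lefschetzInvolution hgr).mul_conj_mul_mul_eq L hgr

end HasLefschetzProperty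

end StringReversal

end Literature.Algebra.Lie

end
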